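/-
Copyright (c) 2026 the pub-hodgecm-mathlib formalisation cell (harness21).  Prover seat hodgecm-mathlib-K2-defs1 (g5), Track B ∕ K2-LIT,
h413 = `stmt-HodgeConjecture-24833`, line `K2_E1_TraceFormulaBeta`, page «EIS-WHITTAKER-2», dealer K2E1-plan (g4) deck #3 (spec 2026-09-04T07:31:48Z,
deal 07:43:28Z): the compact(-open) support boxes `∏_v 𝔭_v^{e_v}𝒪_v ⊂ 𝔸_{K,f}` of the finite Whittaker factors and their rational points `∏_v 𝔭_v^{e_v} ⊂ K`.
-/
import Literature.NumberTheory.Automorphic.FiniteAdeleFactorizable                    -- ★ `isClopen_setOf_valued_le`; brings ★ `isCompact_integralFiniteAdeles`, `mem_integralFiniteAdeles_iff`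
import Literature.NumberTheory.Automorphic.AddCharConductorExponent                   -- ★ `mem_primePowBall_adicCompletion_iff` (`y ∈ 𝔭_v^m ↔ |y|_v ≤ exp (−m)`)
import Literature.NumberTheory.Automorphic.IdeleIdealClass                            -- ★ `FiniteAdeleRing.unitOrd`, `valued_apply_eq_exp_neg_unitOrd`, `unitOrd_eventually_eq_zero`
import Literature.NumberTheory.Automorphic.StrongApproximationGL2                     -- ★ `levelIdeal K 𝔫 = 𝔫𝒪̂_K` (`idealRadius` letters)
import Literature.AnabelianGeometry.AbsoluteAnabelian.ArithmeticLineBundlesOrders     -- ★ `LineBundleOrders.mem_finprod_zpow_iff` (`x ∈ ∏ 𝔭_v^{e_v} ↔ e_v ≤ ord_v x`)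
import HarnessLib

/-!
# h413 ∕ Track B «K2-LIT», «EIS-WHITTAKER-2» deck #3 — `K2E1FractionalIdealAdelicSupport`: the boxes `∏_v 𝔭_v^{e_v}𝒪_v ⊂ 𝔸_{K,f}` are compact (and open),
# and their rational points are the fractional ideal `∏_v 𝔭_v^{e_v}`

Cell `pub/hodgecm-mathlib`, crux H413 = `stmt-HodgeConjecture-24833`, route `HCCMUnconditional`; dealer K2E1-plan (g4), spec 07:31:48Z ∕ 07:43:28Z («the compact-open set
`C_f(𝔞) := ∏_v 𝔭_v^{e_v}𝒪_v` for a fractional ideal `𝔞 = ∏ 𝔭_v^{e_v}` — finitely many `e_v ≠ 0` — with `ι(ξ)_f ∈ C_f(𝔞) ↔ ξ ∈ 𝔞`»), typed against the CONVENTIONS MEMO of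
record `K2/K2E1b-plan/g5/CONVENTIONS-W3W4-EisWhittaker2.K2E1b-plan-g5.md` §0 (S) (support lattice `𝔞(ψ,δ) = ∏_v 𝔭_v^{m_v − a_v}`) and the WIRING TABLE «W5-FINAL» row `hWbd`
(★ p858248 `K2E1WhittakerSeriesConvergenceU2`: ONE compact `Cf ⊂ 𝔸_{K,f}` with `(algebraMap K (AdeleRing (𝓞 K) K) ξ).2 ∉ Cf → W z ξ = 0`).  THEOREMS ONLY (no `def`, no
`instance`, no `notation`, no named-fact hypothesis, no `sorry`; default heartbeats); lane `--kind proof --supports stmt-HodgeConjecture-24833 --as helper` (count-neutral).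
GENERIC number field `K : Type`; exponents `e : HeightOneSpectrum (𝓞 K) → ℤ`; the box is ALWAYS spelled out as
`{x : FiniteAdeleRing (𝓞 K) K | ∀ v, Valued.v (x v) ≤ WithZero.exp (-(e v))}` (`= {x | ∀ v, x_v ∈ 𝔭_v^{e_v}}`, §1's first lemma, in the letters of ★ W2-fin `primePowBall`).

THE MATHEMATICS (Weil, *Basic Number Theory*, Ch. IV §2 and Ch. V §2; Cassels–Fröhlich Ch. II §§13–17).  (§1) Each local ball `{y ∈ K_v : |y|_v ≤ q_v^{−e_v}}` is clopen (★), so the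
box is closed (any `e`) and open as soon as `e_v = 0` for almost all `v` (Mathlib `RestrictedProduct.isOpen_forall_imp_mem`: `∏_{v∉T} 𝒪_v × ∏_{v∈T} balls`).  COMPACTNESS needs only
`0 ≤ e_v` for almost all `v`: choose `0 ≠ d ∈ ∏_{e_v < 0} 𝔭_v^{−e_v} ⊂ 𝓞 K` (a nonzero ideal of a Dedekind domain has a nonzero element; Mathlib `intValuation_le_pow_iff_mem` gives
`|d|_v ≤ q_v^{e_v}` there, and `|d|_v ≤ 1 ≤ q_v^{e_v}` elsewhere), so `d·box ⊂ 𝒪̂_K` and `box ⊂ d⁻¹·𝒪̂_K` — a continuous image of the compact ★ `integralFiniteAdeles` — whence the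
closed box is compact.  (§2) For a finite idele `a` (`|a_v|_v = q_v^{−ord_v a}`, ★ `IdeleIdealClass`), the SCALED box `{x | ∀ v, |a_v⁻¹ x_v|_v ≤ q_v^{−e_v}} = a·∏𝔭_v^{e_v}𝒪_v` IS the
box of exponents `e + ord a` (still eventually `≥ 0`), hence compact: this is W3-cov's support set for the adelic frequency `η = α⁻¹ξ` (★ p858333, `α : (AdeleRing (𝓞 K) K)ˣ`, finite part
`(α⁻¹).2`), and the principal case `a = (d)`, `d ∈ Kˣ`, is the dealer's `d⁻¹·𝔫𝒪̂`.  (§3) RATIONAL POINTS: `(ι ξ)_f` lies in the box iff `|ξ|_v ≤ q_v^{−e_v}` for all `v`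
(`(algebraMap K (AdeleRing (𝓞 K) K) ξ).2 = algebraMap K 𝔸_{K,f} ξ` is `rfl`, Mathlib `valuedAdicCompletion_eq_valuation'`) iff `ξ ∈ ∏_v 𝔭_v^{e_v}` as a Mathlib `FractionalIdeal`
(★ `LineBundleOrders.mem_finprod_zpow_iff`, re-dressed from `ord_v = −log |·|_v` into `Valued.v` letters, plus `ξ = 0`); at an integral ideal `𝔫` (`e = count 𝔫`, Mathlib
`FractionalIdeal.finprod_heightOneSpectrum_factorization'`) the box is ★ `levelIdeal K 𝔫` DEFINITIONALLY (its compactness is ★ `UnitaryGroup.isCompact_levelIdeal`, not restated),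
and `ι(ξ)_f ∈ 𝔫𝒪̂_K ↔ ξ ∈ 𝔫`.  (§4) LOGIC for ★ p858248's letter: `x_f ∉ box ⟹ ∃ v, x_v ∉ 𝔭_v^{e_v}` (where W2-fin (c) ★ p858310 ∕ W2-fin-S §4 make the local
Whittaker factor vanish), packaged as `∃ Cf, IsCompact Cf ∧ ∀ z ξ, (ι ξ)_f ∉ Cf → W z ξ = 0` from a factorwise vanishing hypothesis (plain and `α`-scaled).

* §0 `snd_algebraMap` (`rfl`), `algebraMap_apply_eq_coe`, `valued_algebraMap_apply`.  §1 `forall_valued_le_iff_forall_mem_primePowBall`, `isClosed_setOf_forall_valued_le`, `isOpen_setOf_forall_valued_le`, `exists_ne_zero_forall_intValuation_le`,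
  `setOf_forall_valued_le_subset_image_integralFiniteAdeles`, **`isCompact_setOf_forall_valued_le`** (`0 ≤ e_v` a.e.), `isCompact_setOf_forall_valued_le_of_eventually_eq_zero`.
* §2 `forall_valued_units_inv_mul_le_iff`, `setOf_forall_valued_units_inv_mul_le_eq`, **`isCompact_setOf_forall_valued_units_inv_mul_le`**, **`isCompact_setOf_forall_valued_snd_inv_mul_le`**
  (`α : (AdeleRing (𝓞 K) K)ˣ`), `isCompact_setOf_forall_valued_algebraMap_mul_le` (`d ∈ Kˣ`).
* §3 `algebraMap_mem_setOf_forall_valued_le_iff`, **`mem_finprod_zpow_iff_forall_valuation_le`**,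
  **`snd_algebraMap_mem_setOf_iff_mem_finprod_zpow`** (`ι(ξ)_f ∈ C_f(𝔞) ↔ ξ ∈ 𝔞`), `coe_levelIdeal_eq_setOf`, `algebraMap_mem_levelIdeal_iff[_exists]`.
* §4 `exists_not_mem_primePowBall_of_not_mem[_snd_inv_mul]`, `exists_coe_not_mem_primePowBall_of_snd_algebraMap_not_mem[_snd_inv_mul]`,
  **`exists_isCompact_of_forall_eq_zero`**, **`exists_isCompact_of_forall_eq_zero_idele`** (★ p858248's `∃ Cf, IsCompact Cf ∧ …` letter).
HONEST LABEL.  Count-neutral helper; proves no printed statement; HC_CM is proved only modulo the 7 printed citations (2 remaining named inputs: hLiu418 =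
`stmt-HodgeConjecture-24832`, h413 = `stmt-HodgeConjecture-24833`) until rung 0 closes.

## References
* [WeilBNT1967] A. Weil, *Basic Number Theory* (1967), Ch. IV §2 (compact neighbourhoods `∏_v 𝔭_v^{e_v}𝒪_v` of `0` in `k_A`), Ch. V §2 (`k ∩ ∏ 𝔭_v^{e_v}𝒪_v` = the fractional ideal).
* [CasselsFrohlichANT1967] J. W. S. Cassels, *Global fields*, in Cassels–Fröhlich (1967), Ch. II §§13–17 (restricted topological product; ideles and ideals).
-/

set_option autoImplicit false
set_option linter.dupNamespace false  -- the mandated namespace repeats the summit's segment (`HodgeConjecture.HodgeConjecture`)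

noncomputable section

open IsDedekindDomain IsDedekindDomain.HeightOneSpectrum NumberField Set Filter Topology
open scoped nonZeroDivisors
open Literature.NumberTheory.Automorphic
open Literature.NumberTheory.GaloisRepresentations.IsNonarchimedeanLocalField

namespace Summit.HodgeConjecture.HodgeConjecture.Cruxes.H413.K2E1FractionalIdealAdelicSupport

variable (K : Type) [Field K] [NumberField K]

/-! ## §0 Letters: principal finite adeles -/

/-- The finite part of the principal adele of `ξ` is its principal finite adele (`rfl`; ★ p858248's letter `(algebraMap K (AdeleRing (𝓞 K) K) ξ).2`).
[cite: CasselsFrohlichANT1967, Ch. II §14] -/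
theorem snd_algebraMap (ξ : K) : (algebraMap K (AdeleRing (𝓞 K) K) ξ).2 = algebraMap K (FiniteAdeleRing (𝓞 K) K) ξ := rfl

/-- The `v`-component of the principal finite adele of `ξ` is `ξ ∈ K_v` (Mathlib `FiniteAdeleRing.algebraMap_apply`). [cite: CasselsFrohlichANT1967, Ch. II §14] -/
theorem algebraMap_apply_eq_coe (ξ : K) (v : HeightOneSpectrum (𝓞 K)) :
    algebraMap K (FiniteAdeleRing (𝓞 K) K) ξ v = (ξ : v.adicCompletion K) :=
  IsDedekindDomain.FiniteAdeleRing.algebraMap_apply (𝓞 K) K ξ v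

/-- `|(ι ξ)_v|_v = |ξ|_v` (Mathlib `valuedAdicCompletion_eq_valuation'`). [cite: CasselsFrohlichANT1967, Ch. II §14] -/
theorem valued_algebraMap_apply (ξ : K) (v : HeightOneSpectrum (𝓞 K)) :
    Valued.v (algebraMap K (FiniteAdeleRing (𝓞 K) K) ξ v) = v.valuation K ξ := by
  rw [IsDedekindDomain.FiniteAdeleRing.algebraMap_apply, valuedAdicCompletion_eq_valuation']

/-! ## §1 The boxes `∏_v 𝔭_v^{e_v}𝒪_v ⊂ 𝔸_{K,f}`: closed, open, compact -/

/-- **The box in W2-fin's letters**: `|x_v|_v ≤ q_v^{−e_v}` for all `v` iff `x_v ∈ 𝔭_v^{e_v} = primePowBall K_v e_v` for all `v` (★ `mem_primePowBall_adicCompletion_iff`).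
[cite: WeilBNT1967, Ch. IV §2] -/
theorem forall_valued_le_iff_forall_mem_primePowBall (e : HeightOneSpectrum (𝓞 K) → ℤ) (x : FiniteAdeleRing (𝓞 K) K) :
    (∀ v, Valued.v (x v) ≤ WithZero.exp (-(e v))) ↔ ∀ v : HeightOneSpectrum (𝓞 K), x v ∈ primePowBall (v.adicCompletion K) (e v) := by
  refine forall_congr' fun v => ?_
  rw [mem_primePowBall_adicCompletion_iff]

/-- The box `{x | ∀ v, |x_v|_v ≤ q_v^{−e_v}}` is CLOSED in `𝔸_{K,f}` for every exponent function `e` (an intersection of preimages of the clopen local balls ★ `isClopen_setOf_valued_le`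
under the continuous evaluations). [cite: WeilBNT1967, Ch. IV §2] -/
theorem isClosed_setOf_forall_valued_le (e : HeightOneSpectrum (𝓞 K) → ℤ) :
    IsClosed {x : FiniteAdeleRing (𝓞 K) K | ∀ v, Valued.v (x v) ≤ WithZero.exp (-(e v))} := by
  have h : {x : FiniteAdeleRing (𝓞 K) K | ∀ v, Valued.v (x v) ≤ WithZero.exp (-(e v))} =
      ⋂ v, (fun x : FiniteAdeleRing (𝓞 K) K => x v) ⁻¹' {y : v.adicCompletion K | Valued.v y ≤ WithZero.exp (-(e v))} := by
    ext x
    simp only [mem_setOf_eq, mem_iInter, mem_preimage]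
  rw [h]
  exact isClosed_iInter fun v => (isClopen_setOf_valued_le K v WithZero.exp_ne_zero).isClosed.preimage (RestrictedProduct.continuous_eval v)

/-- The box is OPEN in `𝔸_{K,f}` as soon as `e_v = 0` for almost all `v`: it is `∏_{v ∉ T} 𝒪_v × ∏_{v ∈ T} {|y|_v ≤ q_v^{−e_v}}` for the finite exceptional set `T`
(Mathlib `RestrictedProduct.isOpen_forall_imp_mem` and the clopen local balls). [cite: WeilBNT1967, Ch. IV §2] [cite: CasselsFrohlichANT1967, Ch. II §13] -/
theorem isOpen_setOf_forall_valued_le {e : HeightOneSpectrum (𝓞 K) → ℤ} (he : ∀ᶠ v in cofinite, e v = 0) :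
    IsOpen {x : FiniteAdeleRing (𝓞 K) K | ∀ v, Valued.v (x v) ≤ WithZero.exp (-(e v))} := by
  have hT : Set.Finite {v : HeightOneSpectrum (𝓞 K) | ¬ e v = 0} := he
  set T := hT.toFinset
  have hT' : ∀ v, v ∉ T → e v = 0 := fun v hv => by
    by_contra h
    exact hv (hT.mem_toFinset.mpr h)
  have heq : {x : FiniteAdeleRing (𝓞 K) K | ∀ v, Valued.v (x v) ≤ WithZero.exp (-(e v))} =
      {x : FiniteAdeleRing (𝓞 K) K | ∀ v, v ∉ T → x v ∈ v.adicCompletionIntegers K} ∩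
        ⋂ v ∈ T, (fun x : FiniteAdeleRing (𝓞 K) K => x v) ⁻¹' {y : v.adicCompletion K | Valued.v y ≤ WithZero.exp (-(e v))} := by
    ext x
    simp only [mem_setOf_eq, mem_inter_iff, mem_iInter, mem_preimage, HeightOneSpectrum.mem_adicCompletionIntegers]
    constructor
    · intro hx
      refine ⟨fun v hv => ?_, fun v _ => hx v⟩
      have h := hx v
      rwa [hT' v hv, neg_zero, WithZero.exp_zero] at h
    · rintro ⟨h1, h2⟩ v
      by_cases hv : v ∈ T
      · exact h2 v hv
      · rw [hT' v hv, neg_zero, WithZero.exp_zero]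
        exact h1 v hv
  rw [heq]
  refine IsOpen.inter ?_ (isOpen_biInter_finset fun v _ =>
    (isClopen_setOf_valued_le K v WithZero.exp_ne_zero).isOpen.preimage (RestrictedProduct.continuous_eval v))
  exact RestrictedProduct.isOpen_forall_imp_mem fun v => Valued.isOpen_valuationSubring _

/-- **A principal denominator**: if `0 ≤ e_v` for almost all `v` there is `0 ≠ d ∈ 𝓞 K` with `|d|_v ≤ q_v^{e_v}` for ALL `v` — any nonzero element of the nonzero ideal
`∏_{e_v < 0} 𝔭_v^{−e_v}` (Mathlib `intValuation_le_pow_iff_mem`; at the other places `|d|_v ≤ 1 ≤ q_v^{e_v}`). [cite: CasselsFrohlichANT1967, Ch. II §17] -/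
theorem exists_ne_zero_forall_intValuation_le {e : HeightOneSpectrum (𝓞 K) → ℤ} (he : ∀ᶠ v in cofinite, 0 ≤ e v) :
    ∃ d : 𝓞 K, d ≠ 0 ∧ ∀ v : HeightOneSpectrum (𝓞 K), v.intValuation d ≤ WithZero.exp (e v) := by
  classical
  have hS : Set.Finite {v : HeightOneSpectrum (𝓞 K) | ¬ 0 ≤ e v} := he
  set S := hS.toFinset
  set I : Ideal (𝓞 K) := ∏ v ∈ S, v.asIdeal ^ (-(e v)).toNat with hI
  have hI0 : I ≠ ⊥ := by
    rw [hI, ← Ideal.zero_eq_bot]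
    exact Finset.prod_ne_zero_iff.mpr fun v _ => pow_ne_zero _ (by rw [Ideal.zero_eq_bot]; exact v.ne_bot)
  obtain ⟨d, hdI, hd0⟩ := Submodule.exists_mem_ne_zero_of_ne_bot hI0
  refine ⟨d, hd0, fun v => ?_⟩
  by_cases hv : 0 ≤ e v
  · refine (v.intValuation_le_one d).trans ?_
    rw [← WithZero.exp_zero, WithZero.exp_le_exp]
    exact hv
  · have hvS : v ∈ S := hS.mem_toFinset.mpr hv
    have hdv : d ∈ v.asIdeal ^ (-(e v)).toNat := Ideal.le_of_dvd (Finset.dvd_prod_of_mem _ hvS) hdI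
    rw [← HeightOneSpectrum.intValuation_le_pow_iff_mem] at hdv
    have hcast : ((-(e v)).toNat : ℤ) = -(e v) := Int.toNat_of_nonneg (by omega)
    rwa [hcast, neg_neg] at hdv

/-- **`∏_v 𝔭_v^{e_v}𝒪_v ⊂ d⁻¹·𝒪̂_K`** for the principal denominator `d` of `exists_ne_zero_forall_intValuation_le`: the box is contained in the image of the integral finite adeles
★ `integralFiniteAdeles K = 𝒪̂_K` under multiplication by the finite idele `(d)⁻¹`. [cite: WeilBNT1967, Ch. IV §2] -/
theorem setOf_forall_valued_le_subset_image_integralFiniteAdeles {e : HeightOneSpectrum (𝓞 K) → ℤ} {d : 𝓞 K} (hd0 : d ≠ 0)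
    (hd : ∀ v : HeightOneSpectrum (𝓞 K), v.intValuation d ≤ WithZero.exp (e v)) :
    {x : FiniteAdeleRing (𝓞 K) K | ∀ v, Valued.v (x v) ≤ WithZero.exp (-(e v))} ⊆
      (fun y => (((Units.map (algebraMap K (FiniteAdeleRing (𝓞 K) K)).toMonoidHom
          (Units.mk0 (d : K) (by exact_mod_cast hd0)))⁻¹ : (FiniteAdeleRing (𝓞 K) K)ˣ) : FiniteAdeleRing (𝓞 K) K) * y) ''
        (integralFiniteAdeles K : Set (FiniteAdeleRing (𝓞 K) K)) := by
  set u : (FiniteAdeleRing (𝓞 K) K)ˣ := Units.map (algebraMap K (FiniteAdeleRing (𝓞 K) K)).toMonoidHom (Units.mk0 (d : K) (by exact_mod_cast hd0))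
  intro x hx
  refine ⟨(u : FiniteAdeleRing (𝓞 K) K) * x, ?_, Units.inv_mul_cancel_left u x⟩
  rw [SetLike.mem_coe, mem_integralFiniteAdeles_iff]
  intro v
  rw [HeightOneSpectrum.mem_adicCompletionIntegers]
  have huv : Valued.v ((u : FiniteAdeleRing (𝓞 K) K) v) = v.intValuation d := by
    show Valued.v (algebraMap K (FiniteAdeleRing (𝓞 K) K) (d : K) v) = v.intValuation d
    rw [valued_algebraMap_apply, show ((d : K)) = algebraMap (𝓞 K) K d from rfl, HeightOneSpectrum.valuation_of_algebraMap]
  calc Valued.v (((u : FiniteAdeleRing (𝓞 K) K) * x) v) = Valued.v ((u : FiniteAdeleRing (𝓞 K) K) v) * Valued.v (x v) := by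
        rw [show ((u : FiniteAdeleRing (𝓞 K) K) * x) v = (u : FiniteAdeleRing (𝓞 K) K) v * x v from rfl, map_mul]
    _ ≤ WithZero.exp (e v) * WithZero.exp (-(e v)) := mul_le_mul' (huv ▸ hd v) (hx v)
    _ = 1 := by rw [← WithZero.exp_add, add_neg_cancel, WithZero.exp_zero]

/-- **THE BOX `∏_v 𝔭_v^{e_v}𝒪_v` IS COMPACT** whenever `0 ≤ e_v` for almost all `v` (in particular for finitely many `e_v ≠ 0`): a closed subset of the compact `d⁻¹·𝒪̂_K`
(★ `isCompact_integralFiniteAdeles`, continuity of multiplication). [cite: WeilBNT1967, Ch. IV §2] [cite: CasselsFrohlichANT1967, Ch. II §13] -/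
theorem isCompact_setOf_forall_valued_le {e : HeightOneSpectrum (𝓞 K) → ℤ} (he : ∀ᶠ v in cofinite, 0 ≤ e v) :
    IsCompact {x : FiniteAdeleRing (𝓞 K) K | ∀ v, Valued.v (x v) ≤ WithZero.exp (-(e v))} := by
  obtain ⟨d, hd0, hd⟩ := exists_ne_zero_forall_intValuation_le K he
  exact (((isCompact_integralFiniteAdeles K).image (continuous_const_mul _)).of_isClosed_subset (isClosed_setOf_forall_valued_le K e)
    (setOf_forall_valued_le_subset_image_integralFiniteAdeles K hd0 hd))

/-- The box is compact when `e_v = 0` for almost all `v` (the dealt hypothesis «finitely many `e_v ≠ 0`»). [cite: WeilBNT1967, Ch. IV §2] -/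
theorem isCompact_setOf_forall_valued_le_of_eventually_eq_zero {e : HeightOneSpectrum (𝓞 K) → ℤ} (he : ∀ᶠ v in cofinite, e v = 0) :
    IsCompact {x : FiniteAdeleRing (𝓞 K) K | ∀ v, Valued.v (x v) ≤ WithZero.exp (-(e v))} :=
  isCompact_setOf_forall_valued_le K (he.mono fun _ hv => hv.symm.le)

/-- `0` lies in every box (so the compact set is non-empty). [cite: WeilBNT1967, Ch. IV §2] -/
theorem zero_mem_setOf_forall_valued_le (e : HeightOneSpectrum (𝓞 K) → ℤ) :
    (0 : FiniteAdeleRing (𝓞 K) K) ∈ {x : FiniteAdeleRing (𝓞 K) K | ∀ v, Valued.v (x v) ≤ WithZero.exp (-(e v))} := fun v => by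
  rw [show (0 : FiniteAdeleRing (𝓞 K) K) v = 0 from rfl, map_zero]
  exact zero_le

/-! ## §2 Scaled boxes `a·∏_v 𝔭_v^{e_v}𝒪_v` for a finite idele `a` (W3-cov's adelic frequency `η = α⁻¹ξ`) -/

/-- `|a_v⁻¹ x_v|_v ≤ q_v^{−e_v} ↔ |x_v|_v ≤ q_v^{−(e_v + ord_v a)}` for a finite idele `a` (★ `valued_apply_eq_exp_neg_unitOrd`: `|a_v|_v = q_v^{−ord_v a}`).
[cite: CasselsFrohlichANT1967, Ch. II §17] -/
theorem forall_valued_units_inv_mul_le_iff (a : (FiniteAdeleRing (𝓞 K) K)ˣ) (e : HeightOneSpectrum (𝓞 K) → ℤ) (x : FiniteAdeleRing (𝓞 K) K) :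
    (∀ v, Valued.v (((a⁻¹ : (FiniteAdeleRing (𝓞 K) K)ˣ) : FiniteAdeleRing (𝓞 K) K) v * x v) ≤ WithZero.exp (-(e v))) ↔
      ∀ v, Valued.v (x v) ≤ WithZero.exp (-(e v + FiniteAdeleRing.unitOrd (𝓞 K) K a v)) := by
  refine forall_congr' fun v => ?_
  rw [map_mul, FiniteAdeleRing.valued_apply_eq_exp_neg_unitOrd, FiniteAdeleRing.unitOrd_inv, neg_neg]
  set n : ℤ := FiniteAdeleRing.unitOrd (𝓞 K) K a v
  constructor
  · intro h
    calc Valued.v (x v) = WithZero.exp (-n) * (WithZero.exp n * Valued.v (x v)) := by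
          rw [← mul_assoc, ← WithZero.exp_add, neg_add_cancel, WithZero.exp_zero, one_mul]
      _ ≤ WithZero.exp (-n) * WithZero.exp (-(e v)) := mul_le_mul_right h _
      _ = WithZero.exp (-(e v + n)) := by rw [← WithZero.exp_add]; congr 1; ring
  · intro h
    calc WithZero.exp n * Valued.v (x v) ≤ WithZero.exp n * WithZero.exp (-(e v + n)) := mul_le_mul_right h _
      _ = WithZero.exp (-(e v)) := by rw [← WithZero.exp_add]; congr 1; ring

/-- **The scaled box is a box**: `{x | ∀ v, |a_v⁻¹x_v|_v ≤ q_v^{−e_v}} = {x | ∀ v, |x_v|_v ≤ q_v^{−(e_v + ord_v a)}}` (`a·∏𝔭_v^{e_v}𝒪_v = ∏𝔭_v^{e_v + ord_v a}𝒪_v`).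
[cite: CasselsFrohlichANT1967, Ch. II §17] -/
theorem setOf_forall_valued_units_inv_mul_le_eq (a : (FiniteAdeleRing (𝓞 K) K)ˣ) (e : HeightOneSpectrum (𝓞 K) → ℤ) :
    {x : FiniteAdeleRing (𝓞 K) K | ∀ v, Valued.v (((a⁻¹ : (FiniteAdeleRing (𝓞 K) K)ˣ) : FiniteAdeleRing (𝓞 K) K) v * x v) ≤ WithZero.exp (-(e v))} =
      {x : FiniteAdeleRing (𝓞 K) K | ∀ v, Valued.v (x v) ≤ WithZero.exp (-(e v + FiniteAdeleRing.unitOrd (𝓞 K) K a v))} :=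
  Set.ext fun x => forall_valued_units_inv_mul_le_iff K a e x

/-- **The scaled box `a·∏_v 𝔭_v^{e_v}𝒪_v` is compact** (`0 ≤ e_v` for almost all `v`; `ord_v a = 0` for almost all `v`, ★ `unitOrd_eventually_eq_zero`). [cite: WeilBNT1967, Ch. IV §2] -/
theorem isCompact_setOf_forall_valued_units_inv_mul_le (a : (FiniteAdeleRing (𝓞 K) K)ˣ) {e : HeightOneSpectrum (𝓞 K) → ℤ} (he : ∀ᶠ v in cofinite, 0 ≤ e v) :
    IsCompact {x : FiniteAdeleRing (𝓞 K) K | ∀ v, Valued.v (((a⁻¹ : (FiniteAdeleRing (𝓞 K) K)ˣ) : FiniteAdeleRing (𝓞 K) K) v * x v) ≤ WithZero.exp (-(e v))} := by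
  rw [setOf_forall_valued_units_inv_mul_le_eq]
  refine isCompact_setOf_forall_valued_le K ?_
  filter_upwards [he, FiniteAdeleRing.unitOrd_eventually_eq_zero a] with v hv hv'
  rw [hv', add_zero]
  exact hv

/-- The scaled box is open (`e_v = 0` for almost all `v`). [cite: WeilBNT1967, Ch. IV §2] -/
theorem isOpen_setOf_forall_valued_units_inv_mul_le (a : (FiniteAdeleRing (𝓞 K) K)ˣ) {e : HeightOneSpectrum (𝓞 K) → ℤ} (he : ∀ᶠ v in cofinite, e v = 0) :
    IsOpen {x : FiniteAdeleRing (𝓞 K) K | ∀ v, Valued.v (((a⁻¹ : (FiniteAdeleRing (𝓞 K) K)ˣ) : FiniteAdeleRing (𝓞 K) K) v * x v) ≤ WithZero.exp (-(e v))} := by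
  rw [setOf_forall_valued_units_inv_mul_le_eq]
  refine isOpen_setOf_forall_valued_le K ?_
  filter_upwards [he, FiniteAdeleRing.unitOrd_eventually_eq_zero a] with v hv hv'
  rw [hv', add_zero, hv]

/-- **W3-cov's letter** (★ p858333: `α : (AdeleRing (𝓞 K) K)ˣ`, frequency `α⁻¹ξ`): the set `{x | ∀ v, |((α⁻¹).2)_v · x_v|_v ≤ q_v^{−e_v}} = (α)_f·∏𝔭_v^{e_v}𝒪_v` is compact
(`0 ≤ e_v` for almost all `v`) — the scaled box of the finite idele `(α)_f = Units.map snd α`. [cite: WeilBNT1967, Ch. IV §2] -/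
theorem isCompact_setOf_forall_valued_snd_inv_mul_le (α : (AdeleRing (𝓞 K) K)ˣ) {e : HeightOneSpectrum (𝓞 K) → ℤ} (he : ∀ᶠ v in cofinite, 0 ≤ e v) :
    IsCompact {x : FiniteAdeleRing (𝓞 K) K | ∀ v, Valued.v (((α⁻¹ : (AdeleRing (𝓞 K) K)ˣ) : AdeleRing (𝓞 K) K).2 v * x v) ≤ WithZero.exp (-(e v))} :=
  isCompact_setOf_forall_valued_units_inv_mul_le K (Units.map (RingHom.snd (InfiniteAdeleRing K) (FiniteAdeleRing (𝓞 K) K)).toMonoidHom α) he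

/-- **The dealer's principal case `d⁻¹·∏𝔭_v^{e_v}𝒪_v`** (`d ∈ Kˣ`; at `e = count 𝔫` this is `d⁻¹·𝔫𝒪̂_K`): `{x | ∀ v, |d·x_v|_v ≤ q_v^{−e_v}}` is compact (`0 ≤ e_v` for almost all `v`).
[cite: WeilBNT1967, Ch. IV §2] -/
theorem isCompact_setOf_forall_valued_algebraMap_mul_le {d : K} (hd : d ≠ 0) {e : HeightOneSpectrum (𝓞 K) → ℤ} (he : ∀ᶠ v in cofinite, 0 ≤ e v) :
    IsCompact {x : FiniteAdeleRing (𝓞 K) K | ∀ v, Valued.v (algebraMap K (FiniteAdeleRing (𝓞 K) K) d v * x v) ≤ WithZero.exp (-(e v))} := by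
  have h := isCompact_setOf_forall_valued_units_inv_mul_le K ((Units.map (algebraMap K (FiniteAdeleRing (𝓞 K) K)).toMonoidHom (Units.mk0 d hd))⁻¹) he
  rwa [inv_inv] at h

/-! ## §3 Rational points: `K ∩ ∏_v 𝔭_v^{e_v}𝒪_v = ∏_v 𝔭_v^{e_v}` (Mathlib `FractionalIdeal`), and `levelIdeal K 𝔫 = 𝔫𝒪̂_K` is a box -/

/-- `(ι ξ)_f ∈ ∏_v 𝔭_v^{e_v}𝒪_v ↔ |ξ|_v ≤ q_v^{−e_v}` for all `v`. [cite: WeilBNT1967, Ch. V §2] -/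
theorem algebraMap_mem_setOf_forall_valued_le_iff (e : HeightOneSpectrum (𝓞 K) → ℤ) (ξ : K) :
    algebraMap K (FiniteAdeleRing (𝓞 K) K) ξ ∈ {x : FiniteAdeleRing (𝓞 K) K | ∀ v, Valued.v (x v) ≤ WithZero.exp (-(e v))} ↔
      ∀ v : HeightOneSpectrum (𝓞 K), v.valuation K ξ ≤ WithZero.exp (-(e v)) := by
  simp only [mem_setOf_eq, valued_algebraMap_apply]

/-- **Membership in the fractional ideal `∏_v 𝔭_v^{e_v}` is read off the valuations**: for `e_v = 0` almost everywhere and EVERY `ξ ∈ K` (also `ξ = 0`),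
`ξ ∈ ∏ᶠ_v 𝔭_v^{e_v} ↔ ∀ v, |ξ|_v ≤ q_v^{−e_v}` (★ `LineBundleOrders.mem_finprod_zpow_iff` in `ord_v = −log|·|_v` letters, Mathlib `WithZero.log_le_iff_le_exp`).
[cite: WeilBNT1967, Ch. V §2] [cite: CasselsFrohlichANT1967, Ch. II §17] -/
theorem mem_finprod_zpow_iff_forall_valuation_le {e : HeightOneSpectrum (𝓞 K) → ℤ} (he : ∀ᶠ v in cofinite, e v = 0) (ξ : K) :
    ξ ∈ (∏ᶠ v : HeightOneSpectrum (𝓞 K), (v.asIdeal : FractionalIdeal (𝓞 K)⁰ K) ^ e v) ↔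
      ∀ v : HeightOneSpectrum (𝓞 K), v.valuation K ξ ≤ WithZero.exp (-(e v)) := by
  by_cases hξ : ξ = 0
  · subst hξ
    simp only [map_zero, zero_le, implies_true, iff_true]
    exact FractionalIdeal.zero_mem _
  · rw [Literature.AnabelianGeometry.AbsoluteAnabelian.LineBundleOrders.mem_finprod_zpow_iff e he hξ]
    refine forall_congr' fun v => ?_
    have hv0 : v.valuation K ξ ≠ 0 := (Valuation.ne_zero_iff _).mpr hξ
    rw [Literature.IUT.LogVolume.ord, le_neg, WithZero.log_le_iff_le_exp hv0]

/-- **THE DEALT HEAD `ι(ξ)_f ∈ C_f(𝔞) ↔ ξ ∈ 𝔞`** for `𝔞 = ∏_v 𝔭_v^{e_v}` (finitely many `e_v ≠ 0`), in ★ p858248's letter for the finite part of the principal adele.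
[cite: WeilBNT1967, Ch. V §2] -/
theorem snd_algebraMap_mem_setOf_iff_mem_finprod_zpow {e : HeightOneSpectrum (𝓞 K) → ℤ} (he : ∀ᶠ v in cofinite, e v = 0) (ξ : K) :
    (algebraMap K (AdeleRing (𝓞 K) K) ξ).2 ∈ {x : FiniteAdeleRing (𝓞 K) K | ∀ v, Valued.v (x v) ≤ WithZero.exp (-(e v))} ↔
      ξ ∈ (∏ᶠ v : HeightOneSpectrum (𝓞 K), (v.asIdeal : FractionalIdeal (𝓞 K)⁰ K) ^ e v) := by
  rw [snd_algebraMap, algebraMap_mem_setOf_forall_valued_le_iff, mem_finprod_zpow_iff_forall_valuation_le K he]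

/-- Scaled twin: `(ι ξ)_f ∈ a·∏𝔭_v^{e_v}𝒪_v ↔ ∀ v, |ξ|_v ≤ q_v^{−(e_v + ord_v a)}` for a finite idele `a`. [cite: WeilBNT1967, Ch. V §2] -/
theorem algebraMap_mem_setOf_forall_valued_units_inv_mul_le_iff (a : (FiniteAdeleRing (𝓞 K) K)ˣ) (e : HeightOneSpectrum (𝓞 K) → ℤ) (ξ : K) :
    algebraMap K (FiniteAdeleRing (𝓞 K) K) ξ ∈
        {x : FiniteAdeleRing (𝓞 K) K | ∀ v, Valued.v (((a⁻¹ : (FiniteAdeleRing (𝓞 K) K)ˣ) : FiniteAdeleRing (𝓞 K) K) v * x v) ≤ WithZero.exp (-(e v))} ↔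
      ∀ v : HeightOneSpectrum (𝓞 K), v.valuation K ξ ≤ WithZero.exp (-(e v + FiniteAdeleRing.unitOrd (𝓞 K) K a v)) := by
  rw [setOf_forall_valued_units_inv_mul_le_eq, algebraMap_mem_setOf_forall_valued_le_iff]

/-- **`levelIdeal K 𝔫 = 𝔫𝒪̂_K` IS the box of exponents `count_v 𝔫`** (definitionally: ★ `idealRadius K v 𝔫 = exp (−count_v 𝔫)`). [cite: WeilBNT1967, Ch. IV §2] -/
theorem coe_levelIdeal_eq_setOf (𝔫 : Ideal (𝓞 K)) :
    (levelIdeal K 𝔫 : Set (FiniteAdeleRing (𝓞 K) K)) =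
      {x : FiniteAdeleRing (𝓞 K) K | ∀ v, Valued.v (x v) ≤ WithZero.exp (-(FractionalIdeal.count K v (𝔫 : FractionalIdeal (𝓞 K)⁰ K)))} := rfl

/-- **`ι(ξ)_f ∈ 𝔫𝒪̂_K ↔ ξ ∈ 𝔫`** (as a Mathlib fractional ideal; `𝔫 ≠ 0`, Mathlib `finprod_heightOneSpectrum_factorization'`). [cite: WeilBNT1967, Ch. V §2] -/
theorem algebraMap_mem_levelIdeal_iff {𝔫 : Ideal (𝓞 K)} (h𝔫 : 𝔫 ≠ 0) (ξ : K) :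
    algebraMap K (FiniteAdeleRing (𝓞 K) K) ξ ∈ levelIdeal K 𝔫 ↔ ξ ∈ (𝔫 : FractionalIdeal (𝓞 K)⁰ K) := by
  have hne : (𝔫 : FractionalIdeal (𝓞 K)⁰ K) ≠ 0 := FractionalIdeal.coeIdeal_ne_zero.mpr h𝔫
  rw [← SetLike.mem_coe, coe_levelIdeal_eq_setOf, algebraMap_mem_setOf_forall_valued_le_iff,
    ← mem_finprod_zpow_iff_forall_valuation_le K (FractionalIdeal.finite_factors _), FractionalIdeal.finprod_heightOneSpectrum_factorization' K hne]

/-- `ι(ξ)_f ∈ 𝔫𝒪̂_K ↔ ξ = c` for some `c ∈ 𝔫` (`𝔫 ≠ 0`; Mathlib `FractionalIdeal.mem_coeIdeal`) — so `ι(dξ)_f ∈ 𝔫𝒪̂_K ↔ dξ ∈ 𝔫`, the dealer's `d⁻¹·𝔫𝒪̂` reading at `dξ`.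
[cite: WeilBNT1967, Ch. V §2] -/
theorem algebraMap_mem_levelIdeal_iff_exists {𝔫 : Ideal (𝓞 K)} (h𝔫 : 𝔫 ≠ 0) (ξ : K) :
    algebraMap K (FiniteAdeleRing (𝓞 K) K) ξ ∈ levelIdeal K 𝔫 ↔ ∃ c ∈ 𝔫, (c : K) = ξ := by
  rw [algebraMap_mem_levelIdeal_iff K h𝔫, FractionalIdeal.mem_coeIdeal]

/-! ## §4 Support ⟹ vanishing, in the letter of ★ `K2E1WhittakerSeriesConvergenceU2` (`x_f ∉ Cf → W z ξ = 0`) -/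

/-- Off the box some local component leaves its ball: `x ∉ ∏𝔭_v^{e_v}𝒪_v ⟹ ∃ v, x_v ∉ 𝔭_v^{e_v}` (where ★ W2-fin (c) `integral_weight_mul_addChar_eq_zero_of_not_mem` kills the local factor).
[cite: WeilBNT1967, Ch. IV §2] -/
theorem exists_not_mem_primePowBall_of_not_mem {e : HeightOneSpectrum (𝓞 K) → ℤ} {x : FiniteAdeleRing (𝓞 K) K}
    (hx : x ∉ {x : FiniteAdeleRing (𝓞 K) K | ∀ v, Valued.v (x v) ≤ WithZero.exp (-(e v))}) :
    ∃ v : HeightOneSpectrum (𝓞 K), x v ∉ primePowBall (v.adicCompletion K) (e v) := by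
  rw [mem_setOf_eq, forall_valued_le_iff_forall_mem_primePowBall, not_forall] at hx
  exact hx

/-- Scaled twin for W3-cov's frequency: `x ∉ (α)_f·∏𝔭_v^{e_v}𝒪_v ⟹ ∃ v, ((α⁻¹).2)_v·x_v ∉ 𝔭_v^{e_v}`. [cite: WeilBNT1967, Ch. IV §2] -/
theorem exists_not_mem_primePowBall_of_not_mem_snd_inv_mul (α : (AdeleRing (𝓞 K) K)ˣ) {e : HeightOneSpectrum (𝓞 K) → ℤ} {x : FiniteAdeleRing (𝓞 K) K}
    (hx : x ∉ {x : FiniteAdeleRing (𝓞 K) K | ∀ v, Valued.v (((α⁻¹ : (AdeleRing (𝓞 K) K)ˣ) : AdeleRing (𝓞 K) K).2 v * x v) ≤ WithZero.exp (-(e v))}) :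
    ∃ v : HeightOneSpectrum (𝓞 K), ((α⁻¹ : (AdeleRing (𝓞 K) K)ˣ) : AdeleRing (𝓞 K) K).2 v * x v ∉ primePowBall (v.adicCompletion K) (e v) := by
  simp only [mem_setOf_eq, not_forall] at hx
  obtain ⟨v, hv⟩ := hx
  exact ⟨v, fun h => hv ((mem_primePowBall_adicCompletion_iff v).mp h)⟩

/-- Principal version in W2-fin's letters: `(ι ξ)_f ∉ ∏𝔭_v^{e_v}𝒪_v ⟹ ∃ v, (ξ : K_v) ∉ 𝔭_v^{e_v}` (★ p858248's `(algebraMap K (AdeleRing (𝓞 K) K) ξ).2`,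
W2-fin's `ξ : K_v`). [cite: WeilBNT1967, Ch. V §2] -/
theorem exists_coe_not_mem_primePowBall_of_snd_algebraMap_not_mem {e : HeightOneSpectrum (𝓞 K) → ℤ} {ξ : K}
    (hξ : (algebraMap K (AdeleRing (𝓞 K) K) ξ).2 ∉ {x : FiniteAdeleRing (𝓞 K) K | ∀ v, Valued.v (x v) ≤ WithZero.exp (-(e v))}) :
    ∃ v : HeightOneSpectrum (𝓞 K), (ξ : v.adicCompletion K) ∉ primePowBall (v.adicCompletion K) (e v) := by
  rw [snd_algebraMap] at hξ
  obtain ⟨v, hv⟩ := exists_not_mem_primePowBall_of_not_mem K hξ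
  exact ⟨v, by rwa [algebraMap_apply_eq_coe] at hv⟩

/-- Scaled principal version: `(ι ξ)_f ∉ (α)_f·∏𝔭_v^{e_v}𝒪_v ⟹ ∃ v, ((α⁻¹).2)_v·(ξ : K_v) ∉ 𝔭_v^{e_v}`. [cite: WeilBNT1967, Ch. V §2] -/
theorem exists_coe_not_mem_primePowBall_of_snd_algebraMap_not_mem_snd_inv_mul (α : (AdeleRing (𝓞 K) K)ˣ) {e : HeightOneSpectrum (𝓞 K) → ℤ} {ξ : K}
    (hξ : (algebraMap K (AdeleRing (𝓞 K) K) ξ).2 ∉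
      {x : FiniteAdeleRing (𝓞 K) K | ∀ v, Valued.v (((α⁻¹ : (AdeleRing (𝓞 K) K)ˣ) : AdeleRing (𝓞 K) K).2 v * x v) ≤ WithZero.exp (-(e v))}) :
    ∃ v : HeightOneSpectrum (𝓞 K), ((α⁻¹ : (AdeleRing (𝓞 K) K)ˣ) : AdeleRing (𝓞 K) K).2 v * (ξ : v.adicCompletion K) ∉ primePowBall (v.adicCompletion K) (e v) := by
  rw [snd_algebraMap] at hξ
  obtain ⟨v, hv⟩ := exists_not_mem_primePowBall_of_not_mem_snd_inv_mul K α hξ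
  exact ⟨v, by rwa [algebraMap_apply_eq_coe] at hv⟩

/-- **THE PLUG for ★ p858248's `hWbd` `Cf`-clause (basepoint `g ∈ K_U`, frequency `ξ`)**: if `W z ξ` vanishes as soon as SOME local component `(ι ξ)_v` leaves `𝔭_v^{e_v}` (W2-fin (c) ∕
W2-fin-S §4 at `e_v = m_v − a_v`), and `0 ≤ e_v` for almost all `v`, then ONE compact `Cf ⊂ 𝔸_{K,f}` (the box) has `(ι ξ)_f ∉ Cf → W z ξ = 0` for all `z`. [cite: WeilBNT1967, Ch. IV §2] -/
theorem exists_isCompact_of_forall_eq_zero {X : Type*} (W : X → K → ℂ) {e : HeightOneSpectrum (𝓞 K) → ℤ} (he : ∀ᶠ v in cofinite, 0 ≤ e v)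
    (hW : ∀ z ξ, (∃ v : HeightOneSpectrum (𝓞 K), (ξ : v.adicCompletion K) ∉ primePowBall (v.adicCompletion K) (e v)) → W z ξ = 0) :
    ∃ Cf : Set (FiniteAdeleRing (𝓞 K) K), IsCompact Cf ∧ ∀ z ξ, (algebraMap K (AdeleRing (𝓞 K) K) ξ).2 ∉ Cf → W z ξ = 0 :=
  ⟨{x : FiniteAdeleRing (𝓞 K) K | ∀ v, Valued.v (x v) ≤ WithZero.exp (-(e v))}, isCompact_setOf_forall_valued_le K he,
    fun z ξ hξ => hW z ξ (exists_coe_not_mem_primePowBall_of_snd_algebraMap_not_mem K hξ)⟩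

/-- **THE PLUG, `α`-scaled (general basepoint, W3-cov's frequency `α⁻¹ξ`)**: if `W z ξ = 0` as soon as some `((α⁻¹).2)_v·(ι ξ)_v ∉ 𝔭_v^{e_v}`, then the compact
`Cf = (α)_f·∏𝔭_v^{e_v}𝒪_v` has `(ι ξ)_f ∉ Cf → W z ξ = 0`. [cite: WeilBNT1967, Ch. IV §2] -/
theorem exists_isCompact_of_forall_eq_zero_idele {X : Type*} (W : X → K → ℂ) (α : (AdeleRing (𝓞 K) K)ˣ) {e : HeightOneSpectrum (𝓞 K) → ℤ}
    (he : ∀ᶠ v in cofinite, 0 ≤ e v)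
    (hW : ∀ z ξ, (∃ v : HeightOneSpectrum (𝓞 K),
      ((α⁻¹ : (AdeleRing (𝓞 K) K)ˣ) : AdeleRing (𝓞 K) K).2 v * (ξ : v.adicCompletion K) ∉ primePowBall (v.adicCompletion K) (e v)) → W z ξ = 0) :
    ∃ Cf : Set (FiniteAdeleRing (𝓞 K) K), IsCompact Cf ∧ ∀ z ξ, (algebraMap K (AdeleRing (𝓞 K) K) ξ).2 ∉ Cf → W z ξ = 0 :=
  ⟨{x : FiniteAdeleRing (𝓞 K) K | ∀ v, Valued.v (((α⁻¹ : (AdeleRing (𝓞 K) K)ˣ) : AdeleRing (𝓞 K) K).2 v * x v) ≤ WithZero.exp (-(e v))},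
    isCompact_setOf_forall_valued_snd_inv_mul_le K α he,
    fun z ξ hξ => hW z ξ (exists_coe_not_mem_primePowBall_of_snd_algebraMap_not_mem_snd_inv_mul K α hξ)⟩

/-! ## §5 (ED. 2, append-only) The same tokens in `primePowBall` letters — K2E3-p12 (g6)'s named binder `hcpt` of «W-hWbd» -/

/-- `{x | ∀ v, x_v ∈ 𝔭_v^{c_v}}` (★ W2-fin's `primePowBall`) IS the box `{x | ∀ v, |x_v|_v ≤ q_v^{−c_v}}`. [cite: WeilBNT1967, Ch. IV §2] -/
theorem setOf_forall_mem_primePowBall_eq (c : HeightOneSpectrum (𝓞 K) → ℤ) :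
    {x : FiniteAdeleRing (𝓞 K) K | ∀ v : HeightOneSpectrum (𝓞 K), x v ∈ primePowBall (v.adicCompletion K) (c v)} =
      {x : FiniteAdeleRing (𝓞 K) K | ∀ v, Valued.v (x v) ≤ WithZero.exp (-(c v))} :=
  Set.ext fun x => (forall_valued_le_iff_forall_mem_primePowBall K c x).symm

/-- **`hcpt` BY NAME**: `{x : 𝔸_{K,f} | ∀ v, x_v ∈ 𝔭_v^{c_v}}` is compact when `c_v = 0` for almost all `v`. [cite: WeilBNT1967, Ch. IV §2] -/
theorem isCompact_setOf_forall_mem_primePowBall {c : HeightOneSpectrum (𝓞 K) → ℤ} (hc : ∀ᶠ v in cofinite, c v = 0) :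
    IsCompact {x : FiniteAdeleRing (𝓞 K) K | ∀ v : HeightOneSpectrum (𝓞 K), x v ∈ primePowBall (v.adicCompletion K) (c v)} := by
  rw [setOf_forall_mem_primePowBall_eq]
  exact isCompact_setOf_forall_valued_le_of_eventually_eq_zero K hc

/-- The same under the weaker `0 ≤ c_v` for almost all `v`. [cite: WeilBNT1967, Ch. IV §2] -/
theorem isCompact_setOf_forall_mem_primePowBall_of_eventually_nonneg {c : HeightOneSpectrum (𝓞 K) → ℤ} (hc : ∀ᶠ v in cofinite, 0 ≤ c v) :
    IsCompact {x : FiniteAdeleRing (𝓞 K) K | ∀ v : HeightOneSpectrum (𝓞 K), x v ∈ primePowBall (v.adicCompletion K) (c v)} := by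
  rw [setOf_forall_mem_primePowBall_eq]
  exact isCompact_setOf_forall_valued_le K hc

/-- `(ι ξ)_f ∈ {x | ∀ v, x_v ∈ 𝔭_v^{c_v}} ↔ ξ ∈ ∏ᶠ_v 𝔭_v^{c_v}` (Mathlib `FractionalIdeal`; `c_v = 0` almost everywhere). [cite: WeilBNT1967, Ch. V §2] -/
theorem snd_algebraMap_mem_setOf_forall_mem_primePowBall_iff {c : HeightOneSpectrum (𝓞 K) → ℤ} (hc : ∀ᶠ v in cofinite, c v = 0) (ξ : K) :
    (algebraMap K (AdeleRing (𝓞 K) K) ξ).2 ∈ {x : FiniteAdeleRing (𝓞 K) K | ∀ v : HeightOneSpectrum (𝓞 K), x v ∈ primePowBall (v.adicCompletion K) (c v)} ↔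
      ξ ∈ (∏ᶠ v : HeightOneSpectrum (𝓞 K), (v.asIdeal : FractionalIdeal (𝓞 K)⁰ K) ^ c v) := by
  rw [setOf_forall_mem_primePowBall_eq]
  exact snd_algebraMap_mem_setOf_iff_mem_finprod_zpow K hc ξ

end Summit.HodgeConjecture.HodgeConjecture.Cruxes.H413.K2E1FractionalIdealAdelicSupport

end
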